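import Summits.QuantumFields.YangMills.Theorems.BalabanUVNodesN15PairedFamilyGuard

/-!
# Route «BalabanUVNodes», cluster K4 «SpineRates» — node N15 = NE2: THE M-LIFT — the [B9] size parameter carried as LIVE INDEX DATA, so that a bounded-`M` paired
# family passes the non-degeneracy guard `PairedFamilyGuard.Live` and the by-name layers CERTIFY their per-index content (W-SEAT-START-LIST §2 n15 ITEM 2, cont.)

Cell `pub-ymgap`, WIDTH SEAT `pub-ymgap-dag-n15-w2` (director-ym №197 ∕ HUMAN RULING D-0149), generation 0, file 2.  Filed `--kind proof --supports stmt-QuantumFields-20544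
--as helper` — COUNT-NEUTRAL.  Definition lane (data `def`s = structure updates and `rfl` transports); every theorem is kernel bookkeeping; imports file 1
`BalabanUVNodesN15PairedFamilyGuard` (`Live`, `not_live_of_gf_M_lt`, …); nothing in the tree is modified or re-declared.

WHY.  File 1's junk door (J2) (= dag-ref-B READ-323 ∕ READ-335 ∕ READ-686-ERRATUM, pub-ymgap INBOX l.11794): on a family whose [B9] size parameter `gf.M` is BOUNDED — every
`B6UnitTorusCarrier.unitTorusGeo`-based realised family of the -a lane (`TwoGrid.tgInstance`, dag-n15-c's `fgInstance*`), `M := 1` — `T4EtaRate.NE2PlusOperator` and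
`NE2PlusSite` hold FOR ARBITRARY KERNELS (`M₅ := 2`), so those carriers FAIL `Live` although the lane's proofs bound EVERY index (they take `M₅ := 1`).  The referee's
repair words: «realise the size parameter honestly … so `M₅ ≤ M` is live, or state the per-index `EtaRateIneq342`».  The tree's accepted convention for the first road is
`T4EtaRateSiteTorus.TorusIndex.M` (v1.2): «ALL cube sizes `M ≥ 1` … carried so that the guard `M₅ ≤ M` of the packaged shapes reads: for every index with `M ≥ M₅`» — the
size parameter as FREE INDEX DATA on which (at one-point backgrounds) nothing depends.  dag-n15-a g17 (INBOX l.24300): «the sockets V-F∕V-G take ANY `gf i` with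
`1 ≤ (gf i).M` — an M-indexed (live) producer family plugs in unchanged».  THIS FILE TYPES THAT M-INDEXING ONCE, GENERICALLY: `liftM pi : I × {M : ℝ ∕∕ 1 ≤ M} →
PairedInstance` replaces `gc.M`, `gf.M` by the index's `M` (every other field verbatim), kernels ∕ region ∕ distance are transported by `rfl`, and PER-INDEX bounds with
uniform constants (what the lane's proofs show) give the by-name layers on the LIFTED family — which is `Live`.  So (J2) closes without touching any producer.  The
-a lane's OWN sized editions (genuine kernels, estimates re-assembled guard-free) are dag-n15-a g18's PROGRAMME S (INBOX l.24654) — not typed here (one declarer per statement).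

WHAT THIS MODULE DECLARES ∕ PROVES.
* §1 ONE INSTANCE: `geoM g M := { g with M := M }` (`geoM_M`, `geoM_len`, `geoM_rateFactor` — `rfl`: lengths, distances, test functions, the rate factor do not see `M`),
  `pairM` (the η-pairing transported, `M_eq := rfl`), `instM P M` (`instM_gf_M`, `instM_gc_k`), kernel transports `kerM` ∕ `skerM` and the three `Iff.rfl` faces
  `etaRateIneq342_kerM_iff` ∕ `etaRateIneqSite_skerM_iff` ∕ `etaRateIneqUnit_skerM_iff` (the (3.42)∕(3.48)∕(3.187)-shape inequalities are the SAME at `instM P M`).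
* §2 THE FAMILY: `liftM pi` over `I × {M : ℝ ∕∕ 1 ≤ M}`, `liftKop`, `liftSker`, `liftDist`, `liftCarriers c` (an `NE2Carriers` re-indexed, letters kept),
  `liftM_gf_M` ∕ `liftM_gc_k` (`rfl`; regions are lifted inline `fun j => inΛ j.1`), `liftM_unbounded_M` (for every `M₅` and `i` the index `(i, max 1 M₅)` has `M₅ ≤ gf.M`).
* §3 THE LIFT THEOREMS: ★ `ne2PlusOperator_liftM`, ★ `ne2PlusSite_liftM`, ★ `ne2PlusUnit_liftM` (per-index bounds at every `α₀ > 0` and every regular `U`, uniform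
  constants ⇒ the by-name layer on the lifted family, `M₅ := 1`, `a₀ := 1` inert), ★ `n15At_liftCarriers_of_forall_index` (all three ⇒ `N15At (liftCarriers c)`).
* §4 LIVENESS OF THE LIFT: ★ `live_liftCarriers` (scale count cofinal on the ORIGINAL family ∧ trivial configuration regular ∧ region met ⇒ `Live (liftCarriers c)`;
  M-cofinality is by construction) and the bookkeeping `not_live_and_live_liftCarriers_of_gf_M_lt` (a bounded-`M` family fails the guard, its lift passes it).
* NOT HERE (one declarer per statement): the SIZED editions of the -a lane's OWN two-grid families with their genuine kernels and estimates re-assembled guard-free —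
  dag-n15-a g18 PROGRAMME S (INBOX l.24654: `TGIndexS`, `tgInstanceS`, `n15At_fullG_sized`, …), whose S-C consumes file 1's `Live` ∕ `KeyedLive`; this file is the GENERIC
  lift only (any `PairedInstance` family; e.g. dag-n15-c's `fgInstance*`, sockets' instances), usable as `geoM`∕`instM`∕`kerM`∕`skerM` + the three `Iff.rfl` transports by name.

HONEST FRAMING.  Generic kernel bookkeeping (structure updates, `rfl` transports, re-packaging of displayed per-index hypotheses); NO estimate is proved or asserted here;
at one-point backgrounds the size parameter is INERT either way — the lift makes the by-name statements CERTIFY the per-index content (no `M₅` door), nothing more; a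
lifted family is still a MODEL ∕ `U ≡ 1` family, not NODE 00's [B9] operator layer of Bałaban's run (the pin BY NAME, file 1 (J3)); nothing of Bałaban's is asserted;
NE2⁺ NOT PRINTED ∕ NOT PROVED for d = 4; N15 NOT discharged; K3⁷ OPEN, not claimed; counts UNMOVED (typed 28∕28 · discharged 5∕27, A 5∕28); the Yang–Mills mass gap
(Clay) is NOT proved by any of this — R4 closes the conditional finite-𝕋⁴ rung `BalabanLadder.UV` only; nothing continuum ∕ ℝ⁴ ∕ OS.  No `sorry`, no `instance`, no
`notation`; restate-immune (no Theses import).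
-/

set_option autoImplicit false

noncomputable section

namespace Summit.QuantumFields.YangMills.BalabanUVNodes.N15.PairedFamilyMLift

open Literature.MathematicalPhysics.QuantumFieldTheory.Balaban1983to89
open Literature.MathematicalPhysics.QuantumFieldTheory.Balaban1983to89.T4EtaRate (PairedInstance EtaPairing NE2PlusOperator NE2PlusSite NE2PlusUnit
  EtaRateIneq342 EtaRateIneqSite EtaRateIneqUnit rateFactor)
open Summit.QuantumFields.YangMills.BalabanUVNodes.N15.PairedFamilyGuard (Live not_live_of_gf_M_lt)
open YMDAG.UVSplit (NE2Carriers N15At)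

/-! ## §1 One instance: the geometry with its size parameter replaced, the pairing and the kernels transported -/

/-- The [B9] geometry `g` with its size parameter replaced by `M` (every other field — sites, scales, distances, `k`, `η`, `L`, test functions, norms, cut-offs —
verbatim). [folklore] -/
def geoM (g : B9.Geometry) (M : ℝ) : B9.Geometry := { g with M := M }

/-- Its size parameter is `M` (`rfl`). [bookkeeping] -/
theorem geoM_M (g : B9.Geometry) (M : ℝ) : (geoM g M).M = M := rfl

/-- Its site lengths `L^jη` are `g`'s (`rfl`). [bookkeeping] -/
theorem geoM_len (g : B9.Geometry) (M : ℝ) (y : g.Site) : (geoM g M).len y = g.len y := rfl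

/-- Its rate factor `(η ∕ L^jη)^γ` is `g`'s (`rfl`). [bookkeeping] -/
theorem geoM_rateFactor (g : B9.Geometry) (M γ : ℝ) (y : g.Site) : rateFactor (geoM g M) γ y = rateFactor g γ y := rfl

/-- The η-pairing transported to the size-replaced geometries (every field verbatim; `M_eq := rfl`). [folklore] -/
def pairM {gc gf : B9.Geometry} {Bc Bf : B9.Backgrounds} (P : EtaPairing gc gf Bc Bf) (M : ℝ) : EtaPairing (geoM gc M) (geoM gf M) Bc Bf where
  n := P.n
  k_eq := P.k_eq
  L_eq := P.L_eq
  M_eq := rfl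
  eta_eq := P.eta_eq
  ι := P.ι
  scale_ι := P.scale_ι
  dist_ι := P.dist_ι
  τ := P.τ
  suppIn_τ := P.suppIn_τ
  supNorm_τ := P.supNorm_τ
  avg := P.avg
  avg_one := P.avg_one

/-- **THE SIZE-REPLACED PAIRED INSTANCE** `instM P M`: both geometries get size parameter `M`, backgrounds and pairing unchanged. [folklore] -/
def instM (P : PairedInstance) (M : ℝ) : PairedInstance := ⟨geoM P.gc M, geoM P.gf M, P.Bc, P.Bf, pairM P.pair M⟩

/-- Its fine size parameter is `M` (`rfl`). [bookkeeping] -/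
theorem instM_gf_M (P : PairedInstance) (M : ℝ) : (instM P M).gf.M = M := rfl

/-- Its coarse scale count is `P`'s (`rfl`). [bookkeeping] -/
theorem instM_gc_k (P : PairedInstance) (M : ℝ) : (instM P M).gc.k = P.gc.k := rfl

/-- An operator kernel family transported to `instM P M` (same entries). [folklore] -/
def kerM {P : PairedInstance} (K : B9.KernelFamily P.gc P.Bf) (M : ℝ) : B9.KernelFamily (instM P M).gc (instM P M).Bf :=
  ⟨K.e, K.h1, K.e4, K.h2, K.l2, K.glob⟩

/-- A site kernel transported to `instM P M` (same kernel). [folklore] -/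
def skerM {P : PairedInstance} (K : B9.SiteKernel P.gc P.Bf) (M : ℝ) : B9.SiteKernel (instM P M).gc (instM P M).Bf := ⟨K.ker⟩

/-- The (3.42)-shape inequality is THE SAME at the transported kernel family (`Iff.rfl`). [bookkeeping] -/
theorem etaRateIneq342_kerM_iff {P : PairedInstance} (K : B9.KernelFamily P.gc P.Bf) (M B₀ δ₀ γ : ℝ) (U : P.Bf.Cfg) :
    EtaRateIneq342 (kerM K M) B₀ δ₀ γ U ↔ EtaRateIneq342 K B₀ δ₀ γ U :=
  Iff.rfl

/-- The (3.48)-shape inequality is THE SAME at the transported site kernel (`Iff.rfl`). [bookkeeping] -/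
theorem etaRateIneqSite_skerM_iff {P : PairedInstance} (K : B9.SiteKernel P.gc P.Bf) (d : ℕ) (p M C δ γ : ℝ) (U : P.Bf.Cfg) :
    EtaRateIneqSite d p (skerM K M) C δ γ U ↔ EtaRateIneqSite d p K C δ γ U :=
  Iff.rfl

/-- The (3.187)-shape inequality is THE SAME at the transported unit kernel (`Iff.rfl`). [bookkeeping] -/
theorem etaRateIneqUnit_skerM_iff {P : PairedInstance} (K : B9.SiteKernel P.gc P.Bf) (inΛ : P.gc.Site → Prop) (unitDist : P.gc.Site → P.gc.Site → ℝ)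
    (M B₀ δ₀ θ : ℝ) (k : ℕ) (U : P.Bf.Cfg) :
    EtaRateIneqUnit (skerM K M) inΛ unitDist B₀ δ₀ θ k U ↔ EtaRateIneqUnit K inΛ unitDist B₀ δ₀ θ k U :=
  Iff.rfl

/-! ## §2 The M-indexed family and the lifted carriers -/

/-- **THE M-LIFT OF A PAIRED FAMILY**: index `I × {M : ℝ ∕∕ 1 ≤ M}`, instance `(i, M) ↦ instM (pi i) M` — the size parameter as FREE INDEX DATA (`T4EtaRateSiteTorus.TorusIndex`
v1.2 convention). [folklore] -/
def liftM {I : Type} (pi : I → PairedInstance) : I × {M : ℝ // 1 ≤ M} → PairedInstance := fun j => instM (pi j.1) j.2.1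

/-- Operator kernel families lifted (transported index-wise). [folklore] -/
def liftKop {I : Type} {pi : I → PairedInstance} (Kop : ∀ i, B9.KernelFamily (pi i).gc (pi i).Bf) :
    ∀ j : I × {M : ℝ // 1 ≤ M}, B9.KernelFamily (liftM pi j).gc (liftM pi j).Bf :=
  fun j => kerM (Kop j.1) j.2.1

/-- Site ∕ unit kernels lifted. [folklore] -/
def liftSker {I : Type} {pi : I → PairedInstance} (K : ∀ i, B9.SiteKernel (pi i).gc (pi i).Bf) :
    ∀ j : I × {M : ℝ // 1 ≤ M}, B9.SiteKernel (liftM pi j).gc (liftM pi j).Bf :=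
  fun j => skerM (K j.1) j.2.1

/-- Unit distances lifted. [folklore] -/
def liftDist {I : Type} {pi : I → PairedInstance} (dist : ∀ i, (pi i).gc.Site → (pi i).gc.Site → ℝ) :
    ∀ j : I × {M : ℝ // 1 ≤ M}, (liftM pi j).gc.Site → (liftM pi j).gc.Site → ℝ :=
  fun j => dist j.1

/-- **THE LIFTED N15 CARRIERS**: the family M-lifted, letters `c35`, `p` kept, kernels ∕ region ∕ distance transported. [folklore] -/
def liftCarriers (c : NE2Carriers) : NE2Carriers :=
  ⟨c.I × {M : ℝ // 1 ≤ M}, c.c35, c.p, liftM c.pi, liftKop c.Kop, liftSker c.Ksite, liftSker c.Kunit, fun j => c.inΛ j.1, liftDist c.unitDist⟩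

/-- The lifted fine size parameter IS the index's `M` (`rfl`). [bookkeeping] -/
theorem liftM_gf_M {I : Type} (pi : I → PairedInstance) (j : I × {M : ℝ // 1 ≤ M}) : (liftM pi j).gf.M = j.2.1 := rfl

/-- The lifted coarse scale count is the original one (`rfl`). [bookkeeping] -/
theorem liftM_gc_k {I : Type} (pi : I → PairedInstance) (j : I × {M : ℝ // 1 ≤ M}) : (liftM pi j).gc.k = (pi j.1).gc.k := rfl

/-- **THE LIFT IS M-UNBOUNDED OVER EVERY ORIGINAL INDEX**: `(i, max 1 M₅)` has `M₅ ≤ gf.M`. [bookkeeping] -/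
theorem liftM_unbounded_M {I : Type} (pi : I → PairedInstance) (i : I) (M₅ : ℝ) :
    M₅ ≤ (liftM pi (i, ⟨max 1 M₅, le_max_left 1 M₅⟩)).gf.M :=
  le_max_right 1 M₅

/-! ## §3 The lift theorems: per-index bounds with uniform constants ⇒ the by-name layers on the lifted family -/

section Lift

variable {I : Type} (c35 : ℝ) (pi : I → PairedInstance)

/-- ★ **OPERATOR LAYER ON THE LIFT FROM PER-INDEX BOUNDS**: if at EVERY index, every `α₀ > 0` and every (3.35)-regular configuration the (3.42)-shape η-rate inequality holds
for `Kop i` with UNIFORM `(B₀, δ₀, γ) > 0` (the content the -a lane's proofs establish), then `NE2PlusOperator c35 (liftM pi) (liftKop Kop)` — `M₅ := 1`, `a₀ := 1`, the size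
clause now LIVE and harmless. [bookkeeping] -/
theorem ne2PlusOperator_liftM (Kop : ∀ i, B9.KernelFamily (pi i).gc (pi i).Bf) {B₀ δ₀ γ : ℝ} (hB : 0 < B₀) (hδ : 0 < δ₀) (hγ : 0 < γ)
    (H : ∀ (i : I) (α₀ : ℝ), 0 < α₀ → ∀ U : (pi i).Bf.Cfg, (pi i).Bf.Reg335 c35 α₀ U → EtaRateIneq342 (Kop i) B₀ δ₀ γ U) :
    NE2PlusOperator c35 (liftM pi) (liftKop Kop) :=
  ⟨1, δ₀, 1, B₀, γ, one_pos, hδ, one_pos, hB, hγ, fun j _ α₀ hα _ U hU => (etaRateIneq342_kerM_iff (Kop j.1) j.2.1 B₀ δ₀ γ U).2 (H j.1 α₀ hα U hU)⟩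

/-- ★ **SITE-KERNEL LAYER ON THE LIFT FROM PER-INDEX BOUNDS** (exponents `d`, `p`; uniform `(C, δ, γ) > 0`). [bookkeeping] -/
theorem ne2PlusSite_liftM (d : ℕ) (p : ℝ) (Ksite : ∀ i, B9.SiteKernel (pi i).gc (pi i).Bf) {C δ γ : ℝ} (hC : 0 < C) (hδ : 0 < δ) (hγ : 0 < γ)
    (H : ∀ (i : I) (α₀ : ℝ), 0 < α₀ → ∀ U : (pi i).Bf.Cfg, (pi i).Bf.Reg335 c35 α₀ U → EtaRateIneqSite d p (Ksite i) C δ γ U) :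
    NE2PlusSite d p c35 (liftM pi) (liftSker Ksite) :=
  ⟨1, δ, 1, C, γ, one_pos, hδ, one_pos, hC, hγ, fun j _ α₀ hα _ U hU => (etaRateIneqSite_skerM_iff (Ksite j.1) d p j.2.1 C δ γ U).2 (H j.1 α₀ hα U hU)⟩

/-- ★ **UNIT-LATTICE LAYER ON THE LIFT FROM PER-INDEX BOUNDS** (uniform `(B₀, δ₀) > 0`, `θ ∈ (0, 1)`; the (3.187)-shape bound at every index, every `α₀ > 0`, every
(3.35)∧(3.36)-regular `U`). [bookkeeping] -/
theorem ne2PlusUnit_liftM (Kunit : ∀ i, B9.SiteKernel (pi i).gc (pi i).Bf) (inΛ : ∀ i, (pi i).gc.Site → Prop)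
    (unitDist : ∀ i, (pi i).gc.Site → (pi i).gc.Site → ℝ) {B₀ δ₀ θ : ℝ} (hB : 0 < B₀) (hδ : 0 < δ₀) (hθ0 : 0 < θ) (hθ1 : θ < 1)
    (H : ∀ (i : I) (α₀ : ℝ), 0 < α₀ → ∀ U : (pi i).Bf.Cfg, (pi i).Bf.Reg335 c35 α₀ U → (pi i).Bf.Reg336 c35 α₀ U →
      EtaRateIneqUnit (Kunit i) (inΛ i) (unitDist i) B₀ δ₀ θ (pi i).gc.k U) :
    NE2PlusUnit c35 (liftM pi) (liftSker Kunit) (fun j => inΛ j.1) (liftDist unitDist) :=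
  ⟨δ₀, 1, B₀, θ, hδ, one_pos, hB, hθ0, hθ1, fun j α₀ hα _ U hU hU' =>
    (etaRateIneqUnit_skerM_iff (Kunit j.1) (inΛ j.1) (unitDist j.1) j.2.1 B₀ δ₀ θ (pi j.1).gc.k U).2 (H j.1 α₀ hα U hU hU')⟩

end Lift

/-- ★ **`N15At` ON THE LIFTED CARRIERS FROM PER-INDEX THREE-LAYER BOUNDS** (`d = 4` site exponent as the node reads it). [bookkeeping] -/
theorem n15At_liftCarriers_of_forall_index (c : NE2Carriers) {B₀ δ₀ γ C δ γ' B₁ δ₁ θ : ℝ}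
    (hB : 0 < B₀) (hδ : 0 < δ₀) (hγ : 0 < γ) (hC : 0 < C) (hδ' : 0 < δ) (hγ' : 0 < γ') (hB₁ : 0 < B₁) (hδ₁ : 0 < δ₁) (hθ0 : 0 < θ) (hθ1 : θ < 1)
    (Hop : ∀ (i : c.I) (α₀ : ℝ), 0 < α₀ → ∀ U : (c.pi i).Bf.Cfg, (c.pi i).Bf.Reg335 c.c35 α₀ U → EtaRateIneq342 (c.Kop i) B₀ δ₀ γ U)
    (Hsite : ∀ (i : c.I) (α₀ : ℝ), 0 < α₀ → ∀ U : (c.pi i).Bf.Cfg, (c.pi i).Bf.Reg335 c.c35 α₀ U → EtaRateIneqSite 4 c.p (c.Ksite i) C δ γ' U)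
    (Hunit : ∀ (i : c.I) (α₀ : ℝ), 0 < α₀ → ∀ U : (c.pi i).Bf.Cfg, (c.pi i).Bf.Reg335 c.c35 α₀ U → (c.pi i).Bf.Reg336 c.c35 α₀ U →
      EtaRateIneqUnit (c.Kunit i) (c.inΛ i) (c.unitDist i) B₁ δ₁ θ (c.pi i).gc.k U) :
    N15At (liftCarriers c) :=
  ⟨ne2PlusOperator_liftM c.c35 c.pi c.Kop hB hδ hγ Hop, ne2PlusSite_liftM c.c35 c.pi 4 c.p c.Ksite hC hδ' hγ' Hsite,
    ne2PlusUnit_liftM c.c35 c.pi c.Kunit c.inΛ c.unitDist hB₁ hδ₁ hθ0 hθ1 Hunit⟩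

/-! ## §4 Liveness of the lift -/

/-- ★ **THE LIFT PASSES THE GUARD** as soon as the ORIGINAL family has unbounded scale count, regular trivial configurations and met regions — M-cofinality is by
construction (`(i, max 1 M₅)`). [bookkeeping] -/
theorem live_liftCarriers (c : NE2Carriers) (hk : ∀ k₀ : ℕ, ∃ i : c.I, k₀ ≤ (c.pi i).gc.k)
    (hreg : ∀ (i : c.I) (α₀ : ℝ), 0 < α₀ → (c.pi i).Bf.Reg335 c.c35 α₀ (c.pi i).Bf.one ∧ (c.pi i).Bf.Reg336 c.c35 α₀ (c.pi i).Bf.one)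
    (hΛ : ∀ i : c.I, ∃ y : (c.pi i).gc.Site, c.inΛ i y) : Live (liftCarriers c) := by
  refine ⟨fun M₅ k₀ => ?_, fun j α₀ hα => hreg j.1 α₀ hα, fun j => hΛ j.1⟩
  obtain ⟨i, hi⟩ := hk k₀
  exact ⟨(i, ⟨max 1 M₅, le_max_left 1 M₅⟩), le_max_right 1 M₅, hi⟩

/-- **(J2) AND ITS REPAIR SIDE BY SIDE**: a family with bounded size parameter FAILS the guard (file 1 `not_live_of_gf_M_lt`) while its lift PASSES it. [bookkeeping] -/
theorem not_live_and_live_liftCarriers_of_gf_M_lt (c : NE2Carriers) {M₅ : ℝ} (hM : ∀ i, (c.pi i).gf.M < M₅) (hk : ∀ k₀ : ℕ, ∃ i : c.I, k₀ ≤ (c.pi i).gc.k)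
    (hreg : ∀ (i : c.I) (α₀ : ℝ), 0 < α₀ → (c.pi i).Bf.Reg335 c.c35 α₀ (c.pi i).Bf.one ∧ (c.pi i).Bf.Reg336 c.c35 α₀ (c.pi i).Bf.one)
    (hΛ : ∀ i : c.I, ∃ y : (c.pi i).gc.Site, c.inΛ i y) : ¬ Live c ∧ Live (liftCarriers c) :=
  ⟨not_live_of_gf_M_lt c hM, live_liftCarriers c hk hreg hΛ⟩

end Summit.QuantumFields.YangMills.BalabanUVNodes.N15.PairedFamilyMLift

end
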